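import Literature.AlgebraicGeometry.AbelianSchemes.PolarizationHasTypeOfDualIsogeny   -- ★ the engine `Polarization.hasType_of_fibreIsogeny_of_dualIsogeny_of_coprime`
import Literature.AlgebraicGeometry.AbelianSchemes.SerreTwistLevel                     -- ★ `exists_fibrePoints_comp_serreTranslate_eq`, `isMonHom_serreTranslate`
import Literature.AlgebraicGeometry.AbelianSchemes.FibreHomPointsOfFibrePoints         -- ★ `surjective_map_fibreHom_of_forall_fibrePoints`
import Literature.AlgebraicGeometry.AbelianSchemes.AbelianSchemeDualIsogenyHom          -- ★ `DualPair.isMonHom_dualIsogenyOver`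
import Literature.AlgebraicGeometry.AbelianSchemes.PolarizationUnitHypothesis          -- ★ `Polarization.nonempty_unitHatSlice_iso`
import Literature.AlgebraicGeometry.AbelianSchemes.AbelianSchemeQuotientMulNDescent     -- ★ `mulN`
import Literature.AlgebraicGeometry.Motives.AlgPointsMapSurjectiveAlgClosed            -- ★ `pow_surjective_of_isAlgClosed`, `natCard_ker_powMonoidHom_eq`
import Literature.AlgebraicGeometry.AbelianSchemes.PolarizationKernelSubsetKTheta       -- ★ `Polarization.exists_comp_lam_eq_of_dim_eq` (ED. 2)
import Literature.AlgebraicGeometry.AbelianSchemes.DualPairFibreDimEq                   -- ★ `DualPair.dim_fibre_eq_dim_hat_fibre` (ED. 2)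
import HarnessLib

/-!
# The `hasType` field of the SERRE-TWISTED family — `HasType δ` for ANY polarisation structure on the exact twisted `λ′`

Topic `AlgebraicGeometry/AbelianSchemes`; namespace `Literature.AlgebraicGeometry.AbelianSchemes.AbelianSchemeOver`.  THEOREMS ONLY (no definition,
no named fact, no instance, no notation, no `sorry`; net debt 0).  Cell `hodgecm-mathlib`, FLOOR 0, P6 «MOD programme» (crux hLiu418 =
stmt-HodgeConjecture-24832, `--supports`), X-LEAF sheet line (A-p01 (g28) memo `MEMO-ESHEET-organs.v1`), organ **(S1b)(m3) «`HasType δ` OF THE EXACT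
TWISTED POLARISATION»** (E-side dealer A-p01 (g28) 2026-09-02T06:03:42Z (3) → LA4-p05 (g3); LA7-p01 (g3) keeps (m2)+(m5)) — the twin, for the Serre cover
`ψ_P : A → A ⊗_𝒪 𝔟` of ★ (S1a) `SerreTwistFamilyCover.exists_serreTwist_cover_rows`, of ★ `HeckeQuotientTripleHasType.Polarization.hasType_polarizationDesc_of_count`
(the Hecke isogeny quotient).

THE MATHEMATICS ([MumfordAV1970] §23 Thm. 2, §7 Thm. 4; [MumfordFogartyKirwan1994] App. 7A: the type of a polarisation is read on the kernel of `λ̄` at geometric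
points): in the (S1a) data block (a Serre presentation `(E′, P, Q, N)` of `𝔟 ≅ 𝔞⁻¹` with `N ≠ 0`, the action `ι`, dual pairs `D`, `D_𝔟`, a polarisation `λ` of
`(A, D)`), for ANY polarisation structure `polB` of `(A ⊗ 𝔟, D_𝔟)` whose homomorphism `λ′` is EXACT — row (t3) `ψ_P ≫ λ′ ≫ ψ_P^∨ = λ ≫ [N]` (the output of
(S1a), whose `λ′` is unique; LA7-p01 (g3)'s (m2) supplies the structure) —

  `λ.HasType δ`, `Nat.Coprime N (∏ δᵢ)`, `(N : Ω) ≠ 0` at geometric points, `λ′` onto on geometric points, and the per-point KERNEL COUNT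
  `|ker ψ_{P,s}| · |ker ψ_{P,s}^∨| = |A_s[N]|`  ⟹  `λ′.HasType δ`   (`Polarization.hasType_serreTwist_of_count`).

Everything else is discharged from ★: `ψ_P ≫ λ′ ≫ ψ_P^∨ = λ ^ N` from (t3) (`mulN`, `MonObj.comp_pow`); `ψ_P^∨` a homomorphism over a reduced locally Noetherian base
(★ `DualPair.isMonHom_dualIsogenyOver` with the unit pins of the two polarisations); `ψ_{P,s}` onto on `Ω`-points (★ `exists_fibrePoints_comp_serreTranslate_eq`, the
quasi-inverse `ψ′`, + ★ `surjective_map_fibreHom_of_forall_fibrePoints`); `N`-divisibility and `|A_s[N]| = N^{2 dim}` (★ `pow_surjective_of_isAlgClosed`, ★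
`natCard_ker_powMonoidHom_eq`); the finite-group transport ★ `Polarization.hasType_of_fibreIsogeny_of_dualIsogeny_of_coprime`.  The count binder is the
`|A_s[𝔞]| = N(𝔞)^r` ∕ Cartier-duality bookkeeping of the Serre cover ((S4) hands, marking currency at complex points); `hlamB` is «a polarisation is onto on
geometric points».  In the sheet line `N := n_γ` with `(n_γ) = 𝔞_γ 𝔞̄_γ`, so (S6) must choose the twist ideals prime to `∏ δᵢ` as well as to the level.
Budgets: default heartbeats.

References: [MumfordAV1970] D. Mumford, *Abelian Varieties* (1970), §7 Thm. 4 (p. 72), §23 Thm. 2 (p. 231); [MumfordFogartyKirwan1994] D. Mumford, J. Fogarty,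
F. Kirwan, *Geometric Invariant Theory*, 3rd ed. (1994), App. 7A (pp. 234–235); [RapoportSmithlingZhang2020Diagonal] §3.2 (p. 11), (4.23) (p. 21).
HC_CM is proved only modulo the printed citations (2 remaining named inputs hLiu418 24832, h413 24833) until rung 0 closes — count-neutral.
-/

set_option autoImplicit false

-- as the ★ Serre-tensor files: `Over`/`Scheme` wrappers and `Scheme.Modules` are semireducible
set_option backward.isDefEq.respectTransparency false

noncomputable section

universe u

open CategoryTheory CategoryTheory.Limits AlgebraicGeometry
open scoped MonObj

namespace Literature.AlgebraicGeometry.AbelianSchemes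

namespace AbelianSchemeOver

open Literature.AlgebraicGeometry.Motives

variable {S : Scheme.{u}} [IsReduced S] [IsLocallyNoetherian S] {A : AbelianSchemeOver S} {O : Type*} [CommRing O]
  (act : A.RingAction O) [IsCommMonObj A.X] {m : ℕ} (E' : Matrix (Fin m) (Fin m) O) (hE' : E' * E' = E')
  (P : Matrix (Fin m) (Fin 1) O) (Q : Matrix (Fin 1) (Fin m) O) {N : ℕ}
  (D : A.DualPair) (Db : (serreTensor act E' hE').DualPair)

/-- **THE `hasType` FIELD OF THE SERRE-TWISTED FAMILY.**  In the data block of ★ (S1a) `exists_serreTwist_cover_rows` (Serre presentation `(E′, P, Q, N)`,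
`N ≠ 0`, reduced locally Noetherian base), for a polarisation `λ` of `(A, D)` of type `δ` and ANY polarisation structure `polB` of `(A ⊗ 𝔟, D_𝔟)` whose
homomorphism is EXACT for the cover `ψ_P` — (t3) `ψ_P ≫ polB.lam ≫ ψ_P^∨ = λ ≫ [N]` —: if `N` is prime to `∏ δᵢ` and invertible at every geometric point,
`polB.lam` is onto on geometric points, and at every geometric point `|ker ψ_{P,s}| · |ker ψ_{P,s}^∨| = |A_s[N]|` (finite kernels), then `polB` has type `δ`.
[cite: MumfordAV1970, §23 Thm. 2 (p. 231) and §7 Thm. 4 (p. 72)] [cite: MumfordFogartyKirwan1994, App. 7A (pp. 234–235)]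
[cite: RapoportSmithlingZhang2020Diagonal, §3.2 (p. 11) and §4.3 (4.23) (p. 21)] -/
theorem Polarization.hasType_serreTwist_of_count (hN : N ≠ 0) (hP : E' * P = P) (hQ : Q * E' = Q)
    (hQP : Q * P = Matrix.scalar (Fin 1) (N : O)) (hPQ : P * Q = Matrix.scalar (Fin m) (N : O) * E')
    (pol : A.Polarization D) (polB : (serreTensor act E' hE').Polarization Db)
    (ht3 : haveI := isMonHom_serreTranslate act E' hE' P
      serreTranslate act E' hE' P ≫ polB.lam ≫ DualPair.dualIsogenyOver (serreTranslate act E' hE' P) D Db = pol.lam ≫ D.hat.mulN N)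
    {g : ℕ} {δ : Fin g → ℕ} (hT : pol.HasType δ) (hcop : Nat.Coprime N (∏ i, δ i))
    (hn : ∀ (Ω : Type u) [Field Ω] [IsAlgClosed Ω] (_ : Spec (.of Ω) ⟶ S), (N : Ω) ≠ 0)
    (hlamB : ∀ (Ω : Type u) [Field Ω] [IsAlgClosed Ω] (s : Spec (.of Ω) ⟶ S),
      haveI := polB.isMonHom
      Function.Surjective (AlgPoints.map (L := Ω) (fibreHom polB.lam s).hom.hom.hom))
    (hcount : ∀ (Ω : Type u) [Field Ω] [IsAlgClosed Ω] (s : Spec (.of Ω) ⟶ S),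
      haveI := isMonHom_serreTranslate act E' hE' P
      haveI := polB.isMonHom
      haveI := pol.isMonHom
      haveI : IsMonHom (DualPair.dualIsogenyOver (serreTranslate act E' hE' P) D Db) :=
        DualPair.isMonHom_dualIsogenyOver _ D _ polB.nonempty_unitHatSlice_iso pol.nonempty_unitHatSlice_iso
      Finite (IsMonHom.monoidHom (fibreHom (serreTranslate act E' hE' P) s).hom.hom.hom (specOver Ω Ω)).ker ∧
      Finite (IsMonHom.monoidHom (fibreHom (DualPair.dualIsogenyOver (serreTranslate act E' hE' P) D Db) s).hom.hom.hom
          (specOver Ω Ω)).ker ∧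
      Nat.card (IsMonHom.monoidHom (fibreHom (serreTranslate act E' hE' P) s).hom.hom.hom (specOver Ω Ω)).ker *
        Nat.card (IsMonHom.monoidHom (fibreHom (DualPair.dualIsogenyOver (serreTranslate act E' hE' P) D Db) s).hom.hom.hom
          (specOver Ω Ω)).ker =
        Nat.card (powMonoidHom N : (A.fibre s).toAbelianVariety.Points Ω →* _).ker) :
    polB.HasType δ := by
  haveI := isMonHom_serreTranslate act E' hE' P
  haveI := polB.isMonHom
  haveI := pol.isMonHom
  haveI hmon : IsMonHom (DualPair.dualIsogenyOver (serreTranslate act E' hE' P) D Db) :=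
    DualPair.isMonHom_dualIsogenyOver _ D _ polB.nonempty_unitHatSlice_iso pol.nonempty_unitHatSlice_iso
  -- (t3) as `ψ_P ≫ λ′ ≫ ψ_P^∨ = λ ^ N`
  have hpow : pol.lam ^ N = pol.lam ≫ D.hat.mulN N := by
    rw [AbelianSchemeOver.mulN, MonObj.comp_pow, Category.comp_id]
  have hb : serreTranslate act E' hE' P ≫ polB.lam ≫ DualPair.dualIsogenyOver (serreTranslate act E' hE' P) D Db = pol.lam ^ N :=
    ht3.trans hpow.symm
  refine Polarization.hasType_of_fibreIsogeny_of_dualIsogeny_of_coprime pol polB (serreTranslate act E' hE' P) N hb hT hcop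
    ?_ hlamB ?_ ?_
  · -- `ψ_{P,s}` onto on `Ω`-points (quasi-inverse `ψ′`)
    intro Ω _ _ s
    exact surjective_map_fibreHom_of_forall_fibrePoints s _
      (fun y => exists_fibrePoints_comp_serreTranslate_eq act E' hE' P Q hN hP hQ hQP hPQ s y)
  · -- `N`-divisibility of `A_s(Ω)`
    intro Ω _ _ s
    exact AbelianVariety.pow_surjective_of_isAlgClosed (A.fibre s).toAbelianVariety N (hn Ω s)
  · -- the count, and `|A_s[N](Ω)| = N ^ (2 dim)`
    intro Ω _ _ s
    obtain ⟨hfin, hfind, hprod⟩ := hcount Ω s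
    exact ⟨hfin, hfind, hprod.symm, _,
      AbelianVariety.natCard_ker_powMonoidHom_eq (A.fibre s).toAbelianVariety Ω N (hn Ω s)⟩

/-! ## ED. 2 (append-only) — the `hlamB` binder is generic: every polarisation is onto on geometric points -/

omit [IsReduced S] [IsLocallyNoetherian S] in
/-- **A polarisation is ONTO on geometric points** — `λ̄_s : B_s(Ω) → B̂_s(Ω)` is surjective for every polarisation structure `polB` of an abelian scheme `B → S`
and every geometric point `s` (`dim B̂_s = dim B_s` ★ `DualPair.dim_fibre_eq_dim_hat_fibre`, so `λ̄_s` — finite kernel, equal dimensions — is an isogeny, onto on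
`Ω`-points ★ `Polarization.exists_comp_lam_eq_of_dim_eq`, read on `Points` via ★ `surjective_map_fibreHom_of_forall_fibrePoints`); discharges the `hlamB` binder of
`Polarization.hasType_serreTwist_of_count` (LA7-p01 (g3) 2026-09-02T06:23:47Z remark). [cite: MumfordAV1970, §8 Thm. 1 (p. 77) and §13 Cor. 3 (p. 130)] -/
theorem Polarization.surjective_map_fibreHom_lam {B : AbelianSchemeOver S} {DB : B.DualPair} (polB : B.Polarization DB)
    (Ω : Type u) [Field Ω] [IsAlgClosed Ω] (s : Spec (.of Ω) ⟶ S) :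
    haveI := polB.isMonHom
    Function.Surjective (AlgPoints.map (L := Ω) (fibreHom polB.lam s).hom.hom.hom) := by
  haveI := polB.isMonHom
  exact surjective_map_fibreHom_of_forall_fibrePoints s polB.lam
    (polB.exists_comp_lam_eq_of_dim_eq s (DualPair.dim_fibre_eq_dim_hat_fibre DB s))

/-- **THE `hasType` FIELD OF THE SERRE-TWISTED FAMILY, `hlamB` DISCHARGED** — ★ `Polarization.hasType_serreTwist_of_count` with its binder «`polB.lam` onto on
geometric points» supplied by `Polarization.surjective_map_fibreHom_lam`: for `λ` of type `δ`, ANY polarisation structure `polB` of `(A ⊗ 𝔟, D_𝔟)` exact for `ψ_P`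
((t3)), `N` prime to `∏ δᵢ` and invertible at geometric points, and the kernel count `|ker ψ_{P,s}|·|ker ψ_{P,s}^∨| = |A_s[N]|`: `polB` has type `δ`.
[cite: MumfordAV1970, §23 Thm. 2 (p. 231) and §7 Thm. 4 (p. 72)] [cite: MumfordFogartyKirwan1994, App. 7A (pp. 234–235)]
[cite: RapoportSmithlingZhang2020Diagonal, §3.2 (p. 11) and §4.3 (4.23) (p. 21)] -/
theorem Polarization.hasType_serreTwist_of_count' (hN : N ≠ 0) (hP : E' * P = P) (hQ : Q * E' = Q)
    (hQP : Q * P = Matrix.scalar (Fin 1) (N : O)) (hPQ : P * Q = Matrix.scalar (Fin m) (N : O) * E')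
    (pol : A.Polarization D) (polB : (serreTensor act E' hE').Polarization Db)
    (ht3 : haveI := isMonHom_serreTranslate act E' hE' P
      serreTranslate act E' hE' P ≫ polB.lam ≫ DualPair.dualIsogenyOver (serreTranslate act E' hE' P) D Db = pol.lam ≫ D.hat.mulN N)
    {g : ℕ} {δ : Fin g → ℕ} (hT : pol.HasType δ) (hcop : Nat.Coprime N (∏ i, δ i))
    (hn : ∀ (Ω : Type u) [Field Ω] [IsAlgClosed Ω] (_ : Spec (.of Ω) ⟶ S), (N : Ω) ≠ 0)
    (hcount : ∀ (Ω : Type u) [Field Ω] [IsAlgClosed Ω] (s : Spec (.of Ω) ⟶ S),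
      haveI := isMonHom_serreTranslate act E' hE' P
      haveI := polB.isMonHom
      haveI := pol.isMonHom
      haveI : IsMonHom (DualPair.dualIsogenyOver (serreTranslate act E' hE' P) D Db) :=
        DualPair.isMonHom_dualIsogenyOver _ D _ polB.nonempty_unitHatSlice_iso pol.nonempty_unitHatSlice_iso
      Finite (IsMonHom.monoidHom (fibreHom (serreTranslate act E' hE' P) s).hom.hom.hom (specOver Ω Ω)).ker ∧
      Finite (IsMonHom.monoidHom (fibreHom (DualPair.dualIsogenyOver (serreTranslate act E' hE' P) D Db) s).hom.hom.hom
          (specOver Ω Ω)).ker ∧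
      Nat.card (IsMonHom.monoidHom (fibreHom (serreTranslate act E' hE' P) s).hom.hom.hom (specOver Ω Ω)).ker *
        Nat.card (IsMonHom.monoidHom (fibreHom (DualPair.dualIsogenyOver (serreTranslate act E' hE' P) D Db) s).hom.hom.hom
          (specOver Ω Ω)).ker =
        Nat.card (powMonoidHom N : (A.fibre s).toAbelianVariety.Points Ω →* _).ker) :
    polB.HasType δ :=
  Polarization.hasType_serreTwist_of_count act E' hE' P Q D Db hN hP hQ hQP hPQ pol polB ht3 hT hcop hn
    (fun Ω _ _ s => polB.surjective_map_fibreHom_lam Ω s) hcount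

end AbelianSchemeOver

end Literature.AlgebraicGeometry.AbelianSchemes

end
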